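/-
Copyright (c) 2026 the pub-hodgecm-mathlib formalisation cell (harness21).  Prover seat hodgecm-mathlib-K2E3-p23 (g8), Track B «K2-LIT» ∕ hLiu418 #184♮,
Road I v3, unit U5 «THE CLOSE», FACE-D₀ row `h2₂`: THE TRACE FORM OF `L ⊗ L⁺_v` — U2a's letter `hπ` AT THE INSTANCE (self-named on the OWED §2 of ★ p863351
`K2LiuFirstTermLineLiftRankRowSmallLetters`; LEAD F0P6-plan (g15) BATCH #181 (5) ∕ #183 (2)).  THEOREMS ONLY.
-/
import Summits.HodgeConjecture.HodgeConjecture.Theorems.K2LiuFirstTermLineLiftRankRowSmallLetters   -- ★ p863351 §1.1 `exists_herm_pairing_ne_zero` (generic `hπ`)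
import Summits.HodgeConjecture.HodgeConjecture.Theorems.K2LiuAdeleAddCharTower                    -- ★ p863513 `trace_toLocalRing`, `conjLocal_eq_self_iff` (+ ★ `QuadraticLocalBaseChange`)
import Summits.HodgeConjecture.HodgeConjecture.Theorems.K2LiuTateCharacterLocalTrace              -- ★ (K2Liu-p12) `prod_adeleAddCharAt_eq_adeleAddCharAt_trace` (Tate's local trace compatibility) — ED. 2
import Mathlib.RingTheory.Trace.Basic
import HarnessLib

/-!
# K2_Liu road (hLiu418 = stmt-HodgeConjecture-24832), U5 «THE CLOSE», FACE-D₀ row `h2₂`: THE TRACE FORM OF THE QUADRATIC ALGEBRA `E ⊗_F F_v = F_v ⊕ F_v δ`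
# (`σ ⊗ 1`-invariance, `Tr δ = 0`, `Tr(a + bδ) = 2a`, NON-DEGENERACY) AND U2a's LETTER `hπ` FOR THE PAIRING `π s H = Tr tr(s H)`

Cell `pub/hodgecm-mathlib` (D-0151), Track B, build stream 29; helper lane `--supports stmt-HodgeConjecture-24832 --as helper`, count-neutral; closes no socket.
THEOREMS ONLY (no `def`, no `instance`, no notation, no named-fact hypothesis, no `sorry`).

WHY.  ★ p863351 §1.1 `exists_herm_pairing_ne_zero` proves U2a's letter `hπ` for every pairing `π s H = τ (tr (s H))` with `τ` an `F`-linear, `σ`-invariant functional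
whose form `(x, y) ↦ τ (y x)` is non-degenerate and `2 ≠ 0`.  At the (B1c′) instance the ring is `R := LocalRing E v = E ⊗_F F_v = ∏_{w∣v} E_w`, `σ := conjLocal`,
`τ := Algebra.trace F_v R` (the chirp's quadratic form reads through `Tr ∘ tr`, ★ p863513 §4).  THIS FILE supplies the three inputs for a quadratic `E∕F` with `σ δ = −δ`,
`δ ≠ 0`, `δ² = d ∈ F` (★ `quadraticLocalEquiv`: `R = F_v ⊕ F_v δ`, `(σ ⊗ 1)(a + bδ) = a − bδ`), and the instance of `hπ`:
* §1 `conjLocal_involutive` (via the coordinates), **`trace_conjLocal`** (`Tr ∘ (σ ⊗ 1) = Tr`: `σ ⊗ 1` is an `F_v`-algebra automorphism, Mathlib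
  `Algebra.trace_eq_of_algEquiv`), **`trace_algebraMap_delta`** (`Tr δ = 0`: `Tr δ = Tr (σ δ) = −Tr δ`, `2 ≠ 0`), **`trace_quadraticLocalEquiv`** (`Tr (a + bδ) = 2a`);
* §2 **`exists_trace_mul_ne_zero`** — NON-DEGENERACY: for `x ≠ 0` some `y` has `Tr (y x) ≠ 0` (`x = a + bδ`: `y = 1` if `a ≠ 0`, else `y = δ`, `Tr (δ x) = 2bd`);
* §3 **`exists_herm_pairing_ne_zero_localRing`** — U2a's `hπ` AT THE INSTANCE: for every `F_v`-bilinear `π` with `π s H = Tr (tr (s H))`, every non-zero `σ ⊗ 1`-hermitian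
  `2 × 2` matrix `H` over `R` has a `σ ⊗ 1`-hermitian `s` with `π s H ≠ 0` (★ p863351 §1.1 ∘ §§1–2).
* §4 (ED. 2) **`adeleAddChar_eq_adeleAddCharAt_trace_of_support`** — `ψ_E(a) = ∏_{w∣v} ψ_{E,w}(a_w) = ψ_{F,v}(Tr (a|_v))` for adeles `a` supported over `v`
  (★ K2Liu-p12 `K2LiuTateCharacterLocalTrace.prod_adeleAddCharAt_eq_adeleAddCharAt_trace`, Tate's local trace compatibility; the analytic half of U2a's letter
  `hχ`), and the local `σ`-invariance `prod_adeleAddCharAt_conjLocal`.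
CM instance: `E := L`, `F := L⁺`, `σ := complexConj`, `δ := imagUnit`, `d := imagUnitSq` (★ `complexConj_imagUnit`, ★ `imagUnit_ne_zero`, ★ `imagUnit_mul_self`,
`IsCMField.isQuadraticExtension`).
References: [CasselsFrohlichANT1967] Ch. II §10–§11 (`L ⊗_K K_v`), §19 (19.9); [Rallis1984] §4; [KudlaRallis1994] §3 (the hermitian pairing of the Fourier coefficient).
HONEST LABEL: HC_CM is proved only modulo the 7 printed citations (2 remaining named inputs: hLiu418 = stmt-HodgeConjecture-24832, h413 = stmt-HodgeConjecture-24833)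
until rung 0 closes; this file moves no counter; `h2₂` NOT discharged.
-/

set_option autoImplicit false
set_option linter.dupNamespace false -- the mandated namespace repeats `HodgeConjecture.HodgeConjecture`

noncomputable section

open scoped Matrix
open NumberField IsDedekindDomain
open Literature.NumberTheory.Automorphic Literature.NumberTheory.Automorphic.UnitaryGroup

namespace Summit.HodgeConjecture.HodgeConjecture.Cruxes.HLiu418.K2LiuLocalRingTraceForm

variable (F E : Type) [Field F] [NumberField F] [Field E] [NumberField E] [Algebra F E] [Algebra.IsQuadraticExtension F E]
  (v : HeightOneSpectrum (𝓞 F)) (σ : E ≃ₐ[F] E) {δ : E} (hσδ : σ δ = -δ) (hδ : δ ≠ 0)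

/-! ## §1 `σ ⊗ 1` is an involution preserving the trace; `Tr δ = 0`; `Tr (a + bδ) = 2a` -/

include hσδ hδ in
/-- `σ ⊗ 1` is an involution of `E ⊗_F F_v` (in the coordinates `a + bδ`: `(a, b) ↦ (a, −b)`, ★ `conjLocal_quadraticLocalEquiv`). [cite: CasselsFrohlichANT1967, Ch. II §10] -/
theorem conjLocal_involutive : Function.Involutive (conjLocal E σ v) := fun x => by
  obtain ⟨⟨a, b⟩, rfl⟩ := (quadraticLocalEquiv E v σ hσδ hδ).surjective x
  rw [conjLocal_quadraticLocalEquiv, conjLocal_quadraticLocalEquiv, neg_neg]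

include hσδ hδ in
/-- **`Tr ∘ (σ ⊗ 1) = Tr`**: `σ ⊗ 1` is an `F_v`-algebra automorphism of `E ⊗_F F_v` (★ `conjLocal_toLocalRing`), and the trace is invariant under algebra automorphisms
(Mathlib `Algebra.trace_eq_of_algEquiv`). [cite: CasselsFrohlichANT1967, Ch. II §19 (19.9)] -/
theorem trace_conjLocal (x : LocalRing E v) :
    Algebra.trace (v.adicCompletion F) (LocalRing E v) (conjLocal E σ v x) = Algebra.trace (v.adicCompletion F) (LocalRing E v) x := by
  let eσ : LocalRing E v ≃ₐ[v.adicCompletion F] LocalRing E v :=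
    { toFun := conjLocal E σ v
      invFun := conjLocal E σ v
      left_inv := conjLocal_involutive F E v σ hσδ hδ
      right_inv := conjLocal_involutive F E v σ hσδ hδ
      map_mul' := map_mul _
      map_add' := map_add _
      commutes' := conjLocal_toLocalRing σ v }
  exact Algebra.trace_eq_of_algEquiv eσ x

include σ hσδ hδ in
/-- **`Tr δ = 0`** (`Tr δ = Tr ((σ ⊗ 1) δ) = Tr (−δ)`, `2 ≠ 0` in `F_v`). [cite: CasselsFrohlichANT1967, Ch. II §19 (19.9)] -/
theorem trace_algebraMap_delta : Algebra.trace (v.adicCompletion F) (LocalRing E v) (algebraMap E (LocalRing E v) δ) = 0 := by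
  haveI : CharZero (v.adicCompletion F) := charZero_of_injective_algebraMap (algebraMap F (v.adicCompletion F)).injective
  have h := trace_conjLocal F E v σ hσδ hδ (algebraMap E (LocalRing E v) δ)
  rw [conjLocal_algebraMap, hσδ, map_neg, map_neg] at h
  -- `-t = t` with `2 ≠ 0`
  have h2 : (2 : v.adicCompletion F) * Algebra.trace (v.adicCompletion F) (LocalRing E v) (algebraMap E (LocalRing E v) δ) = 0 := by
    rw [two_mul]
    nth_rewrite 1 [← h]
    rw [neg_add_cancel]
  exact (mul_eq_zero.1 h2).resolve_left two_ne_zero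

include σ hσδ hδ in
/-- **`Tr (ι_v a + ι_v b · δ) = 2a`** (★ p863513 `trace_toLocalRing`: `Tr (ι_v a) = 2a`; `Tr (ι_v b · δ) = b · Tr δ = 0`). [cite: CasselsFrohlichANT1967, Ch. II §19 (19.9)] -/
theorem trace_quadraticLocalEquiv (a b : v.adicCompletion F) :
    Algebra.trace (v.adicCompletion F) (LocalRing E v) (quadraticLocalEquiv E v σ hσδ hδ (a, b)) = 2 • a := by
  have hsmul : toLocalRing E v b * algebraMap E (LocalRing E v) δ = b • algebraMap E (LocalRing E v) δ := by
    rw [Algebra.smul_def, algebraMap_localRing_eq]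
  rw [quadraticLocalEquiv_apply, map_add, K2LiuAdeleAddCharTower.trace_toLocalRing F E v a, hsmul, map_smul,
    trace_algebraMap_delta F E v σ hσδ hδ, smul_zero, add_zero]

/-! ## §2 Non-degeneracy of the trace form -/

include σ hσδ hδ in
/-- **THE TRACE FORM OF `E ⊗_F F_v` IS NON-DEGENERATE**: for `x ≠ 0` there is `y` with `Tr (y x) ≠ 0` — write `x = ι_v a + ι_v b · δ`; if `a ≠ 0` take `y = 1`
(`Tr x = 2a`), else `b ≠ 0` and `y = δ` gives `δ x = ι_v (d b) + ι_v a · δ`, `Tr = 2db` (`δ² = d ≠ 0`). [cite: CasselsFrohlichANT1967, Ch. II §19] -/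
theorem exists_trace_mul_ne_zero {d : F} (hd : δ * δ = algebraMap F E d) (x : LocalRing E v) (hx : x ≠ 0) :
    ∃ y : LocalRing E v, Algebra.trace (v.adicCompletion F) (LocalRing E v) (y * x) ≠ 0 := by
  haveI : CharZero (v.adicCompletion F) := charZero_of_injective_algebraMap (algebraMap F (v.adicCompletion F)).injective
  obtain ⟨⟨a, b⟩, rfl⟩ := (quadraticLocalEquiv E v σ hσδ hδ).surjective x
  by_cases ha : a = 0
  · -- `x = ι b · δ` with `b ≠ 0`: pair with `δ`
    have hb : b ≠ 0 := by
      rintro rfl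
      exact hx (by rw [ha, quadraticLocalEquiv_apply, map_zero, zero_mul, add_zero])
    have hd0 : d ≠ 0 := by
      rintro rfl
      rw [map_zero, mul_self_eq_zero] at hd
      exact hδ hd
    have hd0' : (d : v.adicCompletion F) ≠ 0 := fun h =>
      hd0 ((algebraMap F (v.adicCompletion F)).injective (h.trans (map_zero (algebraMap F (v.adicCompletion F))).symm))
    refine ⟨algebraMap E (LocalRing E v) δ, ?_⟩
    rw [algebraMap_mul_quadraticLocalEquiv E v σ hσδ hδ hd, trace_quadraticLocalEquiv F E v σ hσδ hδ]
    exact smul_ne_zero two_ne_zero (mul_ne_zero hd0' hb)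
  · refine ⟨1, ?_⟩
    rw [one_mul, trace_quadraticLocalEquiv F E v σ hσδ hδ]
    exact smul_ne_zero two_ne_zero ha

/-! ## §3 U2a's letter `hπ` at the instance `R := E ⊗_F F_v`, `σ := σ ⊗ 1`, `π s H := Tr tr(s H)` -/

include hσδ hδ in
/-- **U2a's `hπ` FOR THE TRACE PAIRING ON `E ⊗_F F_v`**: for every `F_v`-bilinear `π` with `π s H = Tr_{E⊗F_v∕F_v} (tr (s · H))`, every non-zero `σ ⊗ 1`-hermitian `2 × 2`
matrix `H` has a `σ ⊗ 1`-hermitian partner `s` with `π s H ≠ 0` (★ p863351 §1.1 `exists_herm_pairing_ne_zero` with `τ := Algebra.trace`, §§1–2).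
[cite: Rallis1984, §4] [cite: KudlaRallis1994, §3] -/
theorem exists_herm_pairing_ne_zero_localRing {d : F} (hd : δ * δ = algebraMap F E d)
    (π : Matrix (Fin 2) (Fin 2) (LocalRing E v) →ₗ[v.adicCompletion F] Matrix (Fin 2) (Fin 2) (LocalRing E v) →ₗ[v.adicCompletion F] v.adicCompletion F)
    (hπτ : ∀ s H, π s H = Algebra.trace (v.adicCompletion F) (LocalRing E v) (s * H).trace)
    (H : Matrix (Fin 2) (Fin 2) (LocalRing E v)) (hH : (H.map (conjLocal E σ v))ᵀ = H) (hH0 : H ≠ 0) :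
    ∃ s : Matrix (Fin 2) (Fin 2) (LocalRing E v), (s.map (conjLocal E σ v))ᵀ = s ∧ π s H ≠ 0 := by
  haveI : CharZero (v.adicCompletion F) := charZero_of_injective_algebraMap (algebraMap F (v.adicCompletion F)).injective
  exact K2LiuFirstTermLineLiftRankRowSmallLetters.exists_herm_pairing_ne_zero (conjLocal E σ v) (Algebra.trace (v.adicCompletion F) (LocalRing E v))
    two_ne_zero (conjLocal_involutive F E v σ hσδ hδ) (trace_conjLocal F E v σ hσδ hδ) (fun x hx => exists_trace_mul_ne_zero F E v σ hσδ hδ hd x hx)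
    π hπτ H hH hH0

/-! ## §4 (ED. 2) Tate's character `ψ_E` on the adeles supported over `v`, through ★ `K2LiuTateCharacterLocalTrace` (Tate's local trace compatibility
`∏_{w ∣ v} ψ_{E,w}(y_w) = ψ_{F,v}(Tr_{E⊗F_v∕F_v} y)` for EVERY `y`, K2Liu-p12): for an adele `a ∈ 𝔸_E` with zero archimedean part and zero components at the finite
places not over `v` (the shape of the arguments `tr(S · X(ι_v z))` of the unipotent characters at `ι_v z ∈ N_Δ(𝔸)`, ★ (d1) `unipDeltaChar_locToAdelic_eq_prod`):
`ψ_E(a) = ∏_{w∣v} ψ_{E,w}(a_w) = ψ_{F,v}(Tr (a|_v))` — the analytic half of ★ U2a's letter `hχ` with NO hermitian-symmetry hypothesis on the argument (it supersedes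
the use of ★ p863513's fixed-subalgebra form); plus the LOCAL `σ`-INVARIANCE `∏_{w∣v} ψ_{E,w}(((σ ⊗ 1) y)_w) = ∏_{w∣v} ψ_{E,w}(y_w)` (★
`adeleAddCharAt_galAdicCompletionMap` and the permutation `w ↦ σ⁻¹ w` of the places over `v`). -/

omit [Algebra.IsQuadraticExtension F E] in
/-- reindexing a product over the places above `v` along the permutation `w ↦ σ⁻¹ w` (★ `under_inv_smul_eq`). [cite: CasselsFrohlichANT1967, Ch. VII §1.1] -/
theorem prod_placesOver_galInv_eq {M : Type*} [CommMonoid M] (f : PlacesOver E v → M) :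
    ∏ w : PlacesOver E v, f ⟨σ⁻¹ • w.1, under_inv_smul_eq σ w⟩ = ∏ w : PlacesOver E v, f w :=
  Fintype.prod_equiv
    { toFun := fun w : PlacesOver E v => (⟨σ⁻¹ • w.1, under_inv_smul_eq σ w⟩ : PlacesOver E v)
      invFun := fun w : PlacesOver E v => (⟨σ⁻¹⁻¹ • w.1, under_inv_smul_eq σ⁻¹ w⟩ : PlacesOver E v)
      left_inv := fun w => Subtype.ext (inv_smul_smul σ⁻¹ w.1)
      right_inv := fun w => Subtype.ext (smul_inv_smul σ⁻¹ w.1) }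
    _ _ fun _ => rfl

omit [Algebra.IsQuadraticExtension F E] in
/-- **LOCAL `σ`-INVARIANCE OF THE PRODUCT OF THE LOCAL CHARACTERS OVER `v`**: `∏_{w∣v} ψ_{E,w}(((σ ⊗ 1) x)_w) = ∏_{w∣v} ψ_{E,w}(x_w)` — componentwise
`((σ ⊗ 1) x)_w = σ_* (x_{σ⁻¹ w})` (★ `conjLocal_apply`) and `ψ_{E,w}(σ_* t) = ψ_{E,σ⁻¹w}(t)` (★ `adeleAddCharAt_galAdicCompletionMap`), then reindex by `w ↦ σ⁻¹ w`.
[cite: CasselsFrohlichANT1967, Ch. XV (Tate), §2.2] [cite: CasselsFrohlichANT1967, Ch. VII §1.1] -/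
theorem prod_adeleAddCharAt_conjLocal (x : LocalRing E v) :
    ∏ w : PlacesOver E v, adeleAddCharAt E w.1 (conjLocal E σ v x w) = ∏ w : PlacesOver E v, adeleAddCharAt E w.1 (x w) := by
  rw [← prod_placesOver_galInv_eq F E v σ (fun w => adeleAddCharAt E w.1 (x w))]
  exact Finset.prod_congr rfl fun w _ => adeleAddCharAt_galAdicCompletionMap F σ (smul_inv_smul σ w.1) _

omit [Algebra.IsQuadraticExtension F E] in
/-- an adele with zero archimedean part and zero components at the finite places not over `v` is the sum of its place inclusions over `v`
(★ p863445 §1 bookkeeping, ★ `AdeleRing.ext'`). [cite: CasselsFrohlichANT1967, Ch. II §14] -/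
theorem eq_sum_adeleSingleHom_of_support (a : AdeleRing (𝓞 E) E) (h1 : a.1 = 0)
    (hoff : ∀ u : HeightOneSpectrum (𝓞 E), u.under (𝓞 F) ≠ v → a.2 u = 0) :
    a = ∑ w : PlacesOver E v, adeleSingleHom E w.1 (a.2 w.1) := by
  refine AdeleRing.ext' E (by rw [h1, K2LiuAdeleAddCharTower.fst_sum_adeleSingleHom]) fun u => ?_
  change a.2 u = (∑ w : PlacesOver E v, adeleSingleHom E w.1 (a.2 w.1)).2 u
  by_cases hu : u.under (𝓞 F) = v
  · rw [K2LiuAdeleAddCharTower.adeleEval_sum_adeleSingleHom_of_over F E v _ u hu]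
  · rw [K2LiuAdeleAddCharTower.adeleEval_sum_adeleSingleHom_of_not_over F E v _ u hu, hoff u hu]

omit [Algebra.IsQuadraticExtension F E] in
/-- **TATE'S CHARACTER ON THE ADELES SUPPORTED OVER `v` IS THE PRODUCT OF THE LOCAL CHARACTERS OVER `v`**: for `a ∈ 𝔸_E` with `a_∞ = 0` and `a_u = 0` at every
finite `u ∤ v`, `ψ_E(a) = ∏_{w∣v} ψ_{E,w}(a_w)` (`a = Σ_{w∣v} ι_w(a_w)`, `ψ_{E,w} = ψ_E ∘ ι_w` by definition). [cite: CasselsFrohlichANT1967, Ch. XV (Tate), §2.2, §4.1] -/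
theorem adeleAddChar_eq_prod_of_support (a : AdeleRing (𝓞 E) E) (h1 : a.1 = 0)
    (hoff : ∀ u : HeightOneSpectrum (𝓞 E), u.under (𝓞 F) ≠ v → a.2 u = 0) :
    adeleAddChar E a = ∏ w : PlacesOver E v, adeleAddCharAt E w.1 (a.2 w.1) := by
  conv_lhs => rw [eq_sum_adeleSingleHom_of_support F E v a h1 hoff]
  rw [Literature.Analysis.Fourier.addChar_map_finset_sum]
  rfl

/-- **THE TOWER IDENTITY FOR TATE'S CHARACTER ON THE ADELES SUPPORTED OVER `v`: `ψ_E(a) = ψ_{F,v}(Tr_{E⊗F_v∕F_v}(a|_v))`** for `a ∈ 𝔸_E` with `a_∞ = 0` and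
`a_u = 0` at every finite `u ∤ v` (`adeleAddChar_eq_prod_of_support` ∘ ★ `K2LiuTateCharacterLocalTrace.prod_adeleAddCharAt_eq_adeleAddCharAt_trace`).  At the (B1c′)
instance (`E := L`, `F := L⁺`): `ψ_S(ι_v z) = ψ_L(tr(S · X(ι_v z))) = ψ_{L⁺,v}(Tr_{L⊗L⁺_v∕L⁺_v} tr(S · X(ι_v z))|_v)` — the analytic half of ★ U2a's letter `hχ`.
[cite: CasselsFrohlichANT1967, Ch. XV (Tate), §2.2, Thm. 4.1.1] [cite: Shimura1997, §18.1 (18.4)] -/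
theorem adeleAddChar_eq_adeleAddCharAt_trace_of_support (a : AdeleRing (𝓞 E) E) (h1 : a.1 = 0)
    (hoff : ∀ u : HeightOneSpectrum (𝓞 E), u.under (𝓞 F) ≠ v → a.2 u = 0) :
    adeleAddChar E a =
      adeleAddCharAt F v (Algebra.trace (v.adicCompletion F) (LocalRing E v) (finiteAdeleToLocal E v a.2)) := by
  rw [adeleAddChar_eq_prod_of_support F E v a h1 hoff, ← K2LiuTateCharacterLocalTrace.prod_adeleAddCharAt_eq_adeleAddCharAt_trace E v]
  rfl

end Summit.HodgeConjecture.HodgeConjecture.Cruxes.HLiu418.K2LiuLocalRingTraceForm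

end
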